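import Mathlib
import Summits.Schanuel.Schanuel.Theses.RigidCore
import Summits.Schanuel.Schanuel.Theorems.RigidCoreMinimalCounterexampleInAclMateFirstFailure
import Summits.Schanuel.Schanuel.Theorems.RigidCoreMinimalCounterexampleInAclSweepToSubspaceOfLine
import Literature.RingTheory.KrullDimension.ZariskiClosureInfinite
import Literature.RingTheory.Elimination.IteratedResultantWalkLine
import Literature.NumberTheory.Transcendental.MinpolyWalkData

/-!
# Stub `stub_sweepLine_hardCore` (crux stmt-Schanuel-0969, line kernel-arithmetic-selection)

The hard core of the sweep, proved by the ITERATED-RESULTANT WALK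
(`Literature.RingTheory.Elimination.Walk.exists_line_subset`)
instead of the tangent-space structure lemma. Outline (notation: `c = 2πi`, `y = eˣ`,
`x_k = x + ck`, `D` = the infinite set of `k ∈ ℤⁿ` with `x_k` a mate of `x`):

1. mates of a first failure have the same `ℚ`-locus (`stub_mateFirstFailure`), so for `k ∈ D`
   the tuple `(x_k, y)` satisfies exactly the `ℚ`-relations of `(x, y)`;
2. the Zariski closure over `ℂ` of `D ⊆ ℂⁿ` has a component `Z(𝔭)` in which `Λ₀ = D ∩ Z(𝔭)` is
   infinite and dense
   (`Literature.RingTheory.KrullDimension.exists_mem_minimalPrimes_inter_infinite`);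
   fix `q₀ = k₁ ∈ Λ₀` and the new base point `x' = x_{k₁}` (same locus, same `y`);
3. if `c` is transcendental over `ℚ(x', y)`, Case A at `x'` (`inW_line_of_transcendental`) gives
   the line `x' + ℂ k₁ ⊆ W_y` at once;
4. otherwise let `F₁ = ℚ(x', y)`, `L = F₁^alg ∩ ℂ ∋ c`, `μ` the minimal polynomial of `c` over
   `F₁`, and `M(X; T) ∈ ℂ[X][T]` the polynomial with `M(x'; T) = b·μ(T)` obtained by clearing
   denominators and substituting `Y = y`; with `O = {z | (z, y) has the ℚ-relations of (x', y)}`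
   the WALK PROPERTY holds: for `z ∈ O`, a root `θ` of `M(z; ·)` and `m = k ∈ Λ₀`, the point
   `z + θ(k - k₁)` is again in `O` — realise `z = ω(x')` by an embedding `ω : L → ℂ` over `ℚ(y)`
   (`Fields.exists_ringHom_apply_eq`), write `θ = ω(θ₀)` with `θ₀` a root of `μ` in `L`, move
   `c ↦ θ₀` by `g ∈ Aut(L/F₁)` (`Fields.exists_algEquiv_apply_eq_of_aeval_minpoly`), and transport
   the relations of `x + ck = x' + c(k - k₁) ∈ O` along `ω ∘ g`;
5. `Walk.exists_line_subset` then yields `k ∈ Λ₀`, `k ≠ k₁`, with the line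
   `x' + ℂ(k - k₁) ⊆ W_y`, i.e. the registered conclusion with `k₀ = k₁`, `v = k - k₁`.

The hypotheses `3 ≤ n`, `¬ IsAlgebraic ℚ(y) c` and the non-concentration hypothesis are not used.
-/

noncomputable section

set_option linter.dupNamespace false

open Polynomial

namespace Summit.Schanuel.Schanuel.Cruxes.MinimalCounterexampleInAcl.KernelArithmeticSelection

open Literature.RingTheory.Elimination Literature.NumberTheory.Transcendental

/-! ## The registered stub -/

set_option maxHeartbeats 400000 in
/-- **Stub 4b-core — the hard core of the sweep** (registered signature; see the module docstring
for the proof by the iterated-resultant walk). -/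
theorem stub_sweepLine_hardCore : ∀ (n : ℕ), 3 ≤ n → ∀ (x : Fin n → ℂ), (LinearIndependent ℚ x ∧ Algebra.trdeg ℚ ↥(IntermediateField.adjoin ℚ (Set.range x ∪ Set.range (Complex.exp ∘ x))) < (n : Cardinal) ∧ ∀ r < n, Literature.NumberTheory.Transcendental.SchanuelRank r) → {k : Fin n → ℤ | LinearIndependent ℚ (fun i => x i + 2 * ↑Real.pi * Complex.I * (k i : ℂ)) ∧ ∀ p : MvPolynomial (Fin n ⊕ Fin n) ℚ, MvPolynomial.aeval (Sum.elim x (Complex.exp ∘ x)) p = 0 → MvPolynomial.aeval (Sum.elim (fun i => x i + 2 * ↑Real.pi * Complex.I * (k i : ℂ)) (Complex.exp ∘ fun i => x i + 2 * ↑Real.pi * Complex.I * (k i : ℂ))) p = 0}.Infinite → IsAlgebraic ↥(IntermediateField.adjoin ℚ (Set.range x ∪ Set.range (Complex.exp ∘ x))) (2 * ↑Real.pi * Complex.I) → ¬ IsAlgebraic ↥(IntermediateField.adjoin ℚ (Set.range (Complex.exp ∘ x))) (2 * ↑Real.pi * Complex.I) → (∀ (k₀ v : Fin n → ℤ), v ≠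 0 → (LinearIndependent ℚ (fun i => x i + 2 * ↑Real.pi * Complex.I * (k₀ i : ℂ)) ∧ ∀ p : MvPolynomial (Fin n ⊕ Fin n) ℚ, MvPolynomial.aeval (Sum.elim x (Complex.exp ∘ x)) p = 0 → MvPolynomial.aeval (Sum.elim (fun i => x i + 2 * ↑Real.pi * Complex.I * (k₀ i : ℂ)) (Complex.exp ∘ fun i => x i + 2 * ↑Real.pi * Complex.I * (k₀ i : ℂ))) p = 0) → {t : ℤ | ∀ p : MvPolynomial (Fin n ⊕ Fin n) ℚ, MvPolynomial.aeval (Sum.elim x (Complex.exp ∘ x)) p = 0 → MvPolynomial.aeval (Sum.elim (fun i => x i + 2 * ↑Real.pi * Complex.I * ((k₀ + t • v) i : ℂ)) (Complex.exp ∘ fun i => x i + 2 * ↑Real.pi * Complex.I * ((k₀ + t • v) i : ℂ))) p = 0}.Finite) → (∃ (k₀ v : Fin n → ℤ), v ≠ 0 ∧ (LinearIndependent ℚ (fun i => x i + 2 * ↑Real.pi * Complex.I * (k₀ i : ℂ)) ∧ ∀ p : MvPolynomial (Fin n ⊕ Fin n) ℚ, MvPolynomial.aeval (Sum.elim x (Complex.exp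 ∘ x)) p = 0 → MvPolynomial.aeval (Sum.elim (fun i => x i + 2 * ↑Real.pi * Complex.I * (k₀ i : ℂ)) (Complex.exp ∘ fun i => x i + 2 * ↑Real.pi * Complex.I * (k₀ i : ℂ))) p = 0) ∧ ∀ s : ℂ, ∀ p : MvPolynomial (Fin n ⊕ Fin n) ℚ, MvPolynomial.aeval (Sum.elim x (Complex.exp ∘ x)) p = 0 → MvPolynomial.aeval (Sum.elim (fun i => x i + 2 * ↑Real.pi * Complex.I * (k₀ i : ℂ) + s * (v i : ℂ)) (Complex.exp ∘ x)) p = 0) := by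
  intro n _hn x hx hD hB _hY _hnc
  classical
  have hc0 : (2 * ↑Real.pi * Complex.I : ℂ) ≠ 0 := by
    simp [Real.pi_ne_zero, Complex.I_ne_zero]
  -- the set `D` of mate-translates
  obtain ⟨Dset, hDset⟩ : ∃ Dset : Set (Fin n → ℤ), Dset = {k : Fin n → ℤ |
      LinearIndependent ℚ (fun i => x i + 2 * ↑Real.pi * Complex.I * (k i : ℂ)) ∧
      ∀ p : MvPolynomial (Fin n ⊕ Fin n) ℚ,
        MvPolynomial.aeval (Sum.elim x (Complex.exp ∘ x)) p = 0 →
        MvPolynomial.aeval (Sum.elim (fun i => x i + 2 * ↑Real.pi * Complex.I * (k i : ℂ))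
          (Complex.exp ∘ fun i => x i + 2 * ↑Real.pi * Complex.I * (k i : ℂ))) p = 0} := ⟨_, rfl⟩
  rw [← hDset] at hD
  have hmem : ∀ k ∈ Dset,
      LinearIndependent ℚ (fun i => x i + 2 * ↑Real.pi * Complex.I * (k i : ℂ)) ∧
      ∀ p : MvPolynomial (Fin n ⊕ Fin n) ℚ,
        MvPolynomial.aeval (Sum.elim x (Complex.exp ∘ x)) p = 0 →
        MvPolynomial.aeval (Sum.elim (fun i => x i + 2 * ↑Real.pi * Complex.I * (k i : ℂ))
          (Complex.exp ∘ fun i => x i + 2 * ↑Real.pi * Complex.I * (k i : ℂ))) p = 0 := by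
    intro k hk
    rw [hDset] at hk
    exact hk
  -- (1) mates have the same locus
  have hiff : ∀ k ∈ Dset, ∀ p : MvPolynomial (Fin n ⊕ Fin n) ℚ,
      MvPolynomial.aeval (Sum.elim (fun i => x i + 2 * ↑Real.pi * Complex.I * (k i : ℂ))
        (Complex.exp ∘ x)) p = 0 ↔
      MvPolynomial.aeval (Sum.elim x (Complex.exp ∘ x)) p = 0 := by
    intro k hk p
    have h1 := stub_mateFirstFailure n x (fun i => x i + 2 * ↑Real.pi * Complex.I * (k i : ℂ)) hx
    have hk' := hmem k hk
    have hM := h1 hk'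
    constructor
    · intro h
      have hxmem : x ∈ {x'' : Fin n → ℂ | ∀ p : MvPolynomial (Fin n ⊕ Fin n) ℚ,
          MvPolynomial.aeval (Sum.elim x (Complex.exp ∘ x)) p = 0 →
          MvPolynomial.aeval (Sum.elim x'' (Complex.exp ∘ x'')) p = 0} := fun p hp => hp
      rw [← hM.2] at hxmem
      have := hxmem p
      rw [cexp_kerTranslate] at this
      exact this h
    · intro h
      have := (hmem k hk).2 p h
      rwa [cexp_kerTranslate] at this
  -- (2) a component of the Zariski closure of `D` with infinitely many, dense, points
  have hcast_inj : Function.Injective (fun k : Fin n → ℤ => fun i => (k i : ℂ)) := by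
    intro k k' h
    funext i
    have := congrFun h i
    simp only [Int.cast_inj] at this
    exact this
  obtain ⟨S, hS⟩ : ∃ S : Set (Fin n → ℂ), S = (fun k : Fin n → ℤ => fun i => (k i : ℂ)) '' Dset :=
    ⟨_, rfl⟩
  have hSinf : S.Infinite := hS ▸ hD.image hcast_inj.injOn
  obtain ⟨𝔭, h𝔭min, hinf, hdense, -, -⟩ :=
    Literature.RingTheory.KrullDimension.exists_mem_minimalPrimes_inter_infinite
      (k := ℂ) (K := ℂ) hSinf
  obtain ⟨Λ₀, hΛ₀⟩ : ∃ Λ₀ : Set (Fin n → ℂ), Λ₀ = S ∩ MvPolynomial.zeroLocus ℂ 𝔭 := ⟨_, rfl⟩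
  rw [← hΛ₀] at hinf hdense
  have hprime : (MvPolynomial.vanishingIdeal ℂ Λ₀ :
      Ideal (MvPolynomial (Fin n) ℂ)).IsPrime := by
    rw [hdense]; exact h𝔭min.1.1
  have hΛS : ∀ m ∈ Λ₀, ∃ k ∈ Dset, (fun i => (k i : ℂ)) = m := by
    intro m hm
    rw [hΛ₀, hS] at hm
    exact hm.1
  obtain ⟨q₀, hq₀⟩ := hinf.nonempty
  obtain ⟨k₁, hk₁D, hk₁q⟩ := hΛS q₀ hq₀
  have hΛ : ∃ m ∈ Λ₀, m ≠ q₀ := hinf.nontrivial.exists_ne q₀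
  -- (3) the new base point `x' = x + c k₁`
  obtain ⟨x', hx'⟩ : ∃ x' : Fin n → ℂ, x' = fun i => x i + 2 * ↑Real.pi * Complex.I * (k₁ i : ℂ) :=
    ⟨_, rfl⟩
  have hy' : Complex.exp ∘ x' = Complex.exp ∘ x := by rw [hx']; exact cexp_kerTranslate x k₁
  have hiff₁ : ∀ p : MvPolynomial (Fin n ⊕ Fin n) ℚ,
      MvPolynomial.aeval (Sum.elim x' (Complex.exp ∘ x)) p = 0 ↔
        MvPolynomial.aeval (Sum.elim x (Complex.exp ∘ x)) p = 0 := by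
    rw [hx']; exact hiff k₁ hk₁D
  by_cases hBk : IsAlgebraic
      (IntermediateField.adjoin ℚ (Set.range (Sum.elim x' (Complex.exp ∘ x))))
      (2 * ↑Real.pi * Complex.I)
  swap
  · -- Case A at `x'`: `c` transcendental over `ℚ(x', y)` gives the line `x' + ℂ k₁` directly
    have hk₁0 : k₁ ≠ 0 := by
      rintro rfl
      apply hBk
      have hxx : x' = x := by rw [hx']; funext i; simp
      rw [hxx, Set.Sum.elim_range]
      exact hB
    refine ⟨k₁, -k₁, neg_ne_zero.2 hk₁0, hmem k₁ hk₁D, ?_⟩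
    intro s p hp
    have hT : Transcendental
        (IntermediateField.adjoin ℚ (Set.range x' ∪ Set.range (Complex.exp ∘ x')))
        (2 * ↑Real.pi * Complex.I) := by
      intro halg
      apply hBk
      rwa [hy', ← Set.Sum.elim_range] at halg
    have hk'' : ∀ p : MvPolynomial (Fin n ⊕ Fin n) ℚ,
        MvPolynomial.aeval (Sum.elim x' (Complex.exp ∘ x')) p = 0 →
        MvPolynomial.aeval (Sum.elim (fun i => x' i + 2 * ↑Real.pi * Complex.I * ((-k₁) i : ℂ))
          (Complex.exp ∘ fun i => x' i + 2 * ↑Real.pi * Complex.I * ((-k₁) i : ℂ))) p = 0 := by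
      intro p hp'
      have e1 : (fun i => x' i + 2 * ↑Real.pi * Complex.I * ((-k₁) i : ℂ)) = x := by
        funext i; rw [hx']; simp
      rw [e1]
      rw [hy'] at hp'
      exact (hiff₁ p).1 hp'
    have h := inW_line_of_transcendental x' (-k₁) hk'' hT s p (by rw [hy']; exact (hiff₁ p).2 hp)
    rw [hy'] at h
    have e2 : (fun i => x i + 2 * ↑Real.pi * Complex.I * (k₁ i : ℂ) + s * ((-k₁) i : ℂ)) =
        fun i => x' i + s * ((-k₁) i : ℂ) := by
      funext i; rw [hx']
    rw [e2]
    exact h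
  -- (4) main case: the walk
  obtain ⟨M, hO, hcroot, hwalkM⟩ := MinpolyWalk.walk_data x' (Complex.exp ∘ x) hBk
  obtain ⟨O, hOdef⟩ : ∃ O : Set (Fin n → ℂ), O = {z | ∀ q : MvPolynomial (Fin n ⊕ Fin n) ℚ,
      MvPolynomial.aeval (Sum.elim z (Complex.exp ∘ x)) q = 0 ↔
        MvPolynomial.aeval (Sum.elim x' (Complex.exp ∘ x)) q = 0} := ⟨_, rfl⟩
  have hOmem : ∀ z, z ∈ O ↔ ∀ q : MvPolynomial (Fin n ⊕ Fin n) ℚ,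
      MvPolynomial.aeval (Sum.elim z (Complex.exp ∘ x)) q = 0 ↔
        MvPolynomial.aeval (Sum.elim x' (Complex.exp ∘ x)) q = 0 := by
    intro z; rw [hOdef]; rfl
  have hx'O : x' ∈ O := (hOmem x').2 fun q => Iff.rfl
  have hO' : ∀ z ∈ O, MvPolynomial.eval z M.leadingCoeff ≠ 0 :=
    fun z hz => hO z ((hOmem z).1 hz)
  -- generators of `P_x` and the finite set `G` cutting out `W_y`
  obtain ⟨P, hP⟩ : ∃ P : Ideal (MvPolynomial (Fin n ⊕ Fin n) ℚ), P = RingHom.ker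
      (MvPolynomial.aeval (Sum.elim x (Complex.exp ∘ x)) :
        MvPolynomial (Fin n ⊕ Fin n) ℚ →ₐ[ℚ] ℂ) :=
    ⟨_, rfl⟩
  obtain ⟨G₀, hG₀⟩ : P.FG := IsNoetherian.noetherian P
  let subY : MvPolynomial (Fin n ⊕ Fin n) ℚ →ₐ[ℚ] MvPolynomial (Fin n) ℂ :=
    MvPolynomial.aeval (Sum.elim MvPolynomial.X (fun i => MvPolynomial.C ((Complex.exp ∘ x) i)))
  obtain ⟨G, hG⟩ : ∃ G : Finset (MvPolynomial (Fin n) ℂ), G = G₀.image subY := ⟨_, rfl⟩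
  have hG₀P : ∀ g₀ ∈ G₀, MvPolynomial.aeval (Sum.elim x (Complex.exp ∘ x)) g₀ = 0 := by
    intro g₀ hg₀
    have : g₀ ∈ P := hG₀ ▸ Ideal.subset_span hg₀
    rw [hP, RingHom.mem_ker] at this
    exact this
  have hOW : ∀ z ∈ O, ∀ g ∈ G, MvPolynomial.eval z g = 0 := by
    intro z hz g hg
    rw [hG, Finset.mem_image] at hg
    obtain ⟨g₀, hg₀, rfl⟩ := hg
    rw [MinpolyWalk.eval_aeval_sumElim, (hOmem z).1 hz g₀, hiff₁ g₀]
    exact hG₀P g₀ hg₀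
  -- the walk property
  have hwalk : ∀ m ∈ Λ₀, ∀ z ∈ O, ∀ θ : ℂ, (M.map (MvPolynomial.eval z)).IsRoot θ →
      z + θ • (m - q₀) ∈ O := by
    intro m hm z hz θ hθ
    obtain ⟨k, hkD, rfl⟩ := hΛS m hm
    have hu : ∀ q : MvPolynomial (Fin n ⊕ Fin n) ℚ,
        MvPolynomial.aeval (Sum.elim (fun i => x' i + 2 * ↑Real.pi * Complex.I * ((k - k₁) i : ℂ))
          (Complex.exp ∘ x)) q = 0 ↔
        MvPolynomial.aeval (Sum.elim x' (Complex.exp ∘ x)) q = 0 := by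
      intro q
      have e : (fun i => x' i + 2 * ↑Real.pi * Complex.I * ((k - k₁) i : ℂ)) =
          fun i => x i + 2 * ↑Real.pi * Complex.I * (k i : ℂ) := by
        funext i; rw [hx']; simp; ring
      rw [e, hiff k hkD q, hiff₁ q]
    have key := hwalkM z ((hOmem z).1 hz) θ hθ (k - k₁) hu
    have e2 : z + θ • ((fun i => (k i : ℂ)) - q₀) =
        fun i => z i + θ * ((k - k₁) i : ℂ) := by
      funext i; rw [← hk₁q]; simp
    rw [e2, hOmem]
    exact key
  -- (5) apply the walk
  obtain ⟨m, hmΛ, hmq, hline⟩ := Walk.exists_line_subset (F := ℂ) G hOW hO' hx'O hc0 hcroot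
    hq₀ hΛ hprime hwalk
  obtain ⟨k, hkD, rfl⟩ := hΛS m hmΛ
  refine ⟨k₁, k - k₁, ?_, hmem k₁ hk₁D, ?_⟩
  · intro h0
    apply hmq
    rw [← hk₁q]
    funext i
    have := congrFun h0 i
    simp only [Pi.sub_apply, Pi.zero_apply, sub_eq_zero] at this
    simp [this]
  · intro s p hp
    have hpP : p ∈ Ideal.span (G₀ : Set (MvPolynomial (Fin n ⊕ Fin n) ℚ)) := by
      rw [hG₀, hP, RingHom.mem_ker]; exact hp
    have hker : Ideal.span (G₀ : Set (MvPolynomial (Fin n ⊕ Fin n) ℚ)) ≤ RingHom.ker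
        (MvPolynomial.aeval (Sum.elim
          (fun i => x i + 2 * ↑Real.pi * Complex.I * (k₁ i : ℂ) + s * ((k - k₁) i : ℂ))
          (Complex.exp ∘ x)) : MvPolynomial (Fin n ⊕ Fin n) ℚ →ₐ[ℚ] ℂ) := by
      rw [Ideal.span_le]
      intro g₀ hg₀
      rw [SetLike.mem_coe, RingHom.mem_ker]
      have h1 := hline s (subY g₀) (by rw [hG]; exact Finset.mem_image_of_mem _ hg₀)
      rw [MinpolyWalk.eval_aeval_sumElim] at h1
      have e3 : (fun i => x i + 2 * ↑Real.pi * Complex.I * (k₁ i : ℂ) + s * ((k - k₁) i : ℂ)) =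
          x' + s • ((fun i => (k i : ℂ)) - q₀) := by
        funext i; rw [hx', ← hk₁q]; simp
      rw [e3]
      exact h1
    exact hker hpP

end Summit.Schanuel.Schanuel.Cruxes.MinimalCounterexampleInAcl.KernelArithmeticSelection

end
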